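/-
Copyright: public-domain mathematics; typed transcription for the H21 Literature library (cell lit-balaban,
reader/typer seat r02 gen 7 = literature-prover-lit-balaban-r02-g7-0; fold owner of block B2).

statement-level skeleton of published theorems with citation tags; proofs where landed; nothing here is a claim about the Yang–Mills mass gap

# Bałaban, *(Higgs)₂,₃ quantum fields in a finite volume. II. An upper bound*, Commun. Math. Phys. **86** (1982) 555–594
# — (3.12) p. 586 in its printed OPERATOR-NORM form: «‖H′_k‖, ‖H″_k‖ ≦ O(1)exp(−δ₁r(Lᵏε)) ≦ O(1)(Lᵏε)^κ» in L²(Λ₅⁽ᵏ⁾), from (3.8)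

[cite: Balaban1982Higgs2]  T. Bałaban, Commun. Math. Phys. 86 (1982) 555–594.  p. 584 [PDF 30], verbatim (OCR layer of the held scan
`paper:balaban1982-cmp86-higgs23-ii` p0030.txt): «According to the remark, the matrix elements h_k(x,x′) of the operator H_k satisfy the
estimates |h_k(x,x′)| ≦ O(1)exp(−δ₁r(Lᵏε))exp(−δ₀|x−x′|), x, x′ ∈ Λ₅^{(k−1)′}. (3.8)»; p. 585 [PDF 31]: «where the forms H′_k, H″_k are
composed of terms associated with the changes in (2.47) and the discussion following, and the term H_k introduced in (3.7). They satisfy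
the estimate (3.8).»; p. 586 [PDF 32], verbatim: «The property (3.8) implies in turn the following estimates for the norms of H′_k, H″_k
in L²(Λ₅⁽ᵏ⁾): ‖H′_k‖, ‖H″_k‖ ≦ O(1)exp(−δ₁r(Lᵏε)) ≦ O(1)(Lᵏε)^κ (3.12) for every κ. Hence for Lᵏε sufficiently small, the operators
G′_k − H′_k and G″_k − H″_k are positive and satisfy the inequalities (3.11) with ½γ₁ instead of γ₁.»  Here r(ε) = R(1 + log ε⁻¹)ʳ,
r > 1 ((2.7) p. 558, the tree's `B2.rFn`), and |x − x′| is the torus distance (I.1.3) in units of the current lattice.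

WHAT THIS MODULE ADDS (SKELETON row **B2.Eq3.11** «(3.11)–(3.12)», owner's cell; companion of p15 gen 2's
`B2Sect3AGaussianStep` §4, which proves the p. 586 sentence from the QUADRATIC-FORM reading `|⟨u,Hu⟩| ≦ C·S·e^{−δ₁r}‖u‖²` of (3.12)
(`abs_quadForm_le_of_kernelBound`) with the lattice row-sum bound `S` LEFT AS A HYPOTHESIS `hS`):
* §1 `l2_opNorm_le_of_rowSum_colSum_le` — the finite Schur test IN OPERATOR NORM: row and column absolute sums `≦ B` ⇒ the
  `ℓ² → ℓ²` operator norm (Mathlib's `Matrix.Norms.L2Operator` norm = the norm of the operator on `EuclideanSpace ℝ X` = L²(X)) is `≦ B`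
  (the tree's `SchurTest.sum_sq_le` by name + `ContinuousLinearMap.opNorm_le_bound`);
* §1 `l2_opNorm_le_of_kernelBound` — **(3.8) ⇒ (3.12), first inequality, operator-norm form**: a kernel bound
  `|h(x,x′)| ≦ Ce^{−δ₁r}e^{−δ₀|x−x′|}` (r14's predicate `B2StepK.KernelBound2109` of (2.109)/(3.8)) with a symmetric distance whose row sums
  `Σ_{x′}e^{−δ₀|x−x′|}` are `≦ S` gives `‖H‖ ≦ C·S·e^{−δ₁r}`;
* §2 `rowSum_tdist_le_of_emb` — THE ROW SUMS ON THE CONCRETE (Higgs)₂,₃ TORI, UNIFORM IN THE VOLUME: for any index set `X` embedded in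
  `T^{(k)} × Fin m` (sites of the typer's `HiggsLattice.Site P k` times `m` components — e.g. `Λ₅⁽ᵏ⁾ × {1,…,d}` for `H′_k` acting on the
  vector fields `A_k`, `Λ₅⁽ᵏ⁾ × {1,…,N}` for `H″_k` acting on `φ_k`) with the distance (I.1.3) of the underlying sites,
  `Σ_{x′∈X} e^{−δ₀|x−x′|} ≦ m·K_d(δ₀)` with `K_d = B4Sect5Proof.latticeConst` — independent of ε, of the torus T_ε and of k
  (`B2Eq230CondShiftBound.sum_exp_neg_tdist_le`, i.e. [B4] §5's torus sums; symmetry of (I.1.3) = `B1Ineq234LevelZero.tdist_comm`);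
* §2 `norm312_le` / `norm312_le_pow` — **(3.12) ON THE CONCRETE LATTICE**: `‖H‖ ≦ C·m·K_d(δ₀)·e^{−δ₁r(Lᵏε)}` and, with r14's
  `B2StepK.rDecayBeatsPowers`, `≦ C·m·K_d(δ₀)·C_κ·(Lᵏε)^κ` for every κ, `0 < Lᵏε ≦ 1` — the printed O(1)'s being `C·m·K_d(δ₀)` and
  `C·m·K_d(δ₀)·C_κ`, depending on (C, m, d, δ₀) and (δ₁, R, r, κ) only;
* §3 `abs_quadForm_le_norm312` / `sentence586_lattice` — the quadratic-form bound and p15's p. 586 sentence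
  `B2Sect3AGaussianStep.sentence586` with the volume hypothesis `hS` and the symmetry of the distance SUPPLIED on the concrete tori: for
  the printed ranges δ₁, R > 0, r > 1 and constants C ≥ 0, γ > 0 there is a threshold ℓ₀ > 0 depending on (δ₁, R, r, C, m, d, δ₀, γ) only
  such that for every scale 0 < Lᵏε ≦ ℓ₀, every torus of the model, every index set X ↪ T^{(k)} × Fin m and all symmetric G, H on X with
  (3.11) `G ≧ γ(Lᵏε)²I` and (3.8) for the kernel of H: `G − H` is positive definite and `≧ ½γ(Lᵏε)²I`.

HONEST SCOPE.  The content is the Schur test and the volume-uniform lattice sums; the identification of the forms `⟨A_k,G′_kA_k⟩`,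
`⟨φ_k,G″_kφ_k⟩` of (3.9) with Prop. 3.1's quadratic form and the construction of H′_k, H″_k from (2.47)/(3.7) are NOT transcribed (the row
B2.Eq3.11 keeps its `typed` head); (3.8) enters as r14's kernel-bound predicate, as in p15's file.  Theorems only; no definition, no
`Prop` fact; nothing of B2 is used as a hypothesis beyond the printed shapes named above.
-/
import Mathlib
import Literature.MathematicalPhysics.QuantumFieldTheory.Balaban1983to89.B2Sect3AGaussianStep
import Literature.MathematicalPhysics.QuantumFieldTheory.Balaban1983to89.SchurTest
import Literature.MathematicalPhysics.QuantumFieldTheory.Balaban1983to89.B2Eq230CondShiftBound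

/-! # (3.12) p. 586 in operator norm, from (3.8); the lattice sums discharged on the concrete tori

statement-level skeleton of published theorems with citation tags; proofs where landed; nothing here is a claim about the Yang–Mills mass gap -/

open scoped BigOperators Real Matrix.Norms.L2Operator
open Finset Matrix WithLp

namespace Literature.MathematicalPhysics.QuantumFieldTheory.Balaban1983to89.B2Ineq312OperatorNorm

open Literature.MathematicalPhysics.QuantumFieldTheory.Balaban1983to89

/-! ## §1 Schur's test in operator norm; (3.8) ⇒ (3.12) first inequality -/

section Schur

-- `X : Type` (universe 0) to match r14's `B2StepK.KernelBound2109 {X : Type}` and p15's `sentence586`.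
variable {X : Type} [Fintype X] [DecidableEq X]

/-- **Finite Schur test, operator-norm form** (the mechanism behind *"(3.8) implies … the estimates for the norms of H′_k, H″_k in
L²(Λ₅⁽ᵏ⁾)"*): if every row sum and every column sum of `|h(x,x′)|` is `≦ B` (`B ≥ 0`), then the `L²(X) → L²(X)` operator norm of
`H` is `≦ B`.  (`SchurTest.sum_sq_le`: `‖Hv‖₂² ≦ B·B·‖v‖₂²`.) [folklore] [cite: Balaban1982Higgs2, (3.12) p.586] -/
theorem l2_opNorm_le_of_rowSum_colSum_le (H : Matrix X X ℝ) {B : ℝ} (hB : 0 ≤ B)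
    (hrow : ∀ x, ∑ x', |H x x'| ≤ B) (hcol : ∀ x', ∑ x, |H x x'| ≤ B) : ‖H‖ ≤ B := by
  rw [Matrix.l2_opNorm_def]
  refine ContinuousLinearMap.opNorm_le_bound _ hB fun v => ?_
  set w := (toEuclideanLin (𝕜 := ℝ) (m := X) (n := X)).trans LinearMap.toContinuousLinearMap H v with hw
  have hsq : ‖w‖ ^ 2 ≤ (B * ‖v‖) ^ 2 := by
    rw [EuclideanSpace.real_norm_sq_eq, mul_pow, EuclideanSpace.real_norm_sq_eq]
    have hS := SchurTest.sum_sq_le (fun x x' => H x x') (fun j => v j) hrow hcol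
    have hwi : ∀ i, w i = ∑ j, H i j * v j := fun i => rfl
    calc ∑ i, w i ^ 2 = ∑ i, (∑ j, H i j * v j) ^ 2 := by simp_rw [hwi]
      _ ≤ B * B * ∑ j, v j ^ 2 := hS
      _ = B ^ 2 * ∑ j, v j ^ 2 := by ring
  exact (pow_le_pow_iff_left₀ (norm_nonneg _) (by positivity) two_ne_zero).mp hsq

/-- **(3.8) ⇒ (3.12), first inequality, in operator norm**: a kernel bound `|h(x,x′)| ≦ Ce^{−δ₁r}e^{−δ₀|x−x′|}` (r14's
`B2StepK.KernelBound2109`, the shape of (2.109)/(3.8)) with respect to a symmetric distance whose row sums satisfy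
`Σ_{x′}e^{−δ₀|x−x′|} ≦ S` gives `‖H‖ ≦ C·S·e^{−δ₁r}` in `L²(X)` — the printed `‖H′_k‖ ≦ O(1)exp(−δ₁r(Lᵏε))` with `O(1) = C·S`.
[cite: Balaban1982Higgs2, (3.8) p.584, (3.12) p.586] -/
theorem l2_opNorm_le_of_kernelBound (H : Matrix X X ℝ) {dist : X → X → ℝ} {C δ₁ δ₀ r S : ℝ} (hC : 0 ≤ C)
    (hS0 : 0 ≤ S) (hk : B2StepK.KernelBound2109 (fun x x' => H x x') dist C δ₁ δ₀ r)
    (hsymm : ∀ x x', dist x x' = dist x' x) (hS : ∀ x, ∑ x', Real.exp (-(δ₀ * dist x x')) ≤ S) :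
    ‖H‖ ≤ C * S * Real.exp (-(δ₁ * r)) := by
  have hCe : 0 ≤ C * Real.exp (-(δ₁ * r)) := mul_nonneg hC (Real.exp_pos _).le
  have hrow : ∀ x, ∑ x', |H x x'| ≤ C * S * Real.exp (-(δ₁ * r)) := by
    intro x
    calc ∑ x', |H x x'| ≤ ∑ x', C * Real.exp (-(δ₁ * r)) * Real.exp (-(δ₀ * dist x x')) :=
          Finset.sum_le_sum fun x' _ => hk x x'
      _ = C * Real.exp (-(δ₁ * r)) * ∑ x', Real.exp (-(δ₀ * dist x x')) := by rw [Finset.mul_sum]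
      _ ≤ C * Real.exp (-(δ₁ * r)) * S := mul_le_mul_of_nonneg_left (hS x) hCe
      _ = C * S * Real.exp (-(δ₁ * r)) := by ring
  have hcol : ∀ x', ∑ x, |H x x'| ≤ C * S * Real.exp (-(δ₁ * r)) := by
    intro x'
    calc ∑ x, |H x x'| ≤ ∑ x, C * Real.exp (-(δ₁ * r)) * Real.exp (-(δ₀ * dist x x')) :=
          Finset.sum_le_sum fun x _ => hk x x'
      _ = C * Real.exp (-(δ₁ * r)) * ∑ x, Real.exp (-(δ₀ * dist x' x)) := by
          rw [Finset.mul_sum]; simp_rw [hsymm _ x']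
      _ ≤ C * Real.exp (-(δ₁ * r)) * S := mul_le_mul_of_nonneg_left (hS x') hCe
      _ = C * S * Real.exp (-(δ₁ * r)) := by ring
  exact l2_opNorm_le_of_rowSum_colSum_le H (by positivity) hrow hcol

/-- The operator-norm bound controls the quadratic form: `|⟨u,Hu⟩| ≦ ‖H‖·‖u‖²` (Cauchy–Schwarz in `L²(X)`), so every
operator-norm estimate of (3.12) feeds the quadratic-form hypothesis of p15's `B2Sect3AGaussianStep.sentence586_of_norm312`.
[folklore] [cite: Balaban1982Higgs2, (3.12) p.586] -/
theorem abs_quadForm_le_l2_opNorm (H : Matrix X X ℝ) (u : X → ℝ) : |u ⬝ᵥ (H *ᵥ u)| ≤ ‖H‖ * (u ⬝ᵥ u) := by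
  -- `⟨u, Hu⟩ = ⟪toLp u, toEuclideanCLM H (toLp u)⟫` and `‖toEuclideanCLM H‖ = ‖H‖`
  set v : EuclideanSpace ℝ X := toLp 2 u with hv
  have hinner : u ⬝ᵥ (H *ᵥ u) = @inner ℝ _ _ v (toEuclideanCLM (n := X) (𝕜 := ℝ) H v) := by
    rw [Matrix.inner_toEuclideanCLM]
  have hnormv : u ⬝ᵥ u = ‖v‖ ^ 2 := by
    rw [EuclideanSpace.real_norm_sq_eq]; simp only [dotProduct, pow_two]; rfl
  rw [hinner, hnormv]
  calc |@inner ℝ _ _ v (toEuclideanCLM (n := X) (𝕜 := ℝ) H v)|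
      ≤ ‖v‖ * ‖toEuclideanCLM (n := X) (𝕜 := ℝ) H v‖ := abs_real_inner_le_norm _ _
    _ ≤ ‖v‖ * (‖toEuclideanCLM (n := X) (𝕜 := ℝ) H‖ * ‖v‖) :=
        mul_le_mul_of_nonneg_left (ContinuousLinearMap.le_opNorm _ _) (norm_nonneg _)
    _ = ‖toEuclideanCLM (n := X) (𝕜 := ℝ) H‖ * ‖v‖ ^ 2 := by ring
    _ = ‖H‖ * ‖v‖ ^ 2 := rfl

end Schur

/-! ## §2 (3.12) on the concrete (Higgs)₂,₃ tori: the lattice sums discharged uniformly in the volume -/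

section Lattice

variable {P : HiggsLattice.Params} {k : ℕ}

variable {X : Type} [Fintype X]

/-- **The row sums of (3.8)/(3.12) on the concrete tori, uniform in the volume**: for an index set `X` embedded in
`T^{(k)} × Fin m` (sites × `m` components — `Λ₅⁽ᵏ⁾ × {1,…,d}` for `H′_k` on the vector fields, `Λ₅⁽ᵏ⁾ × {1,…,N}` for `H″_k` on the
scalar fields) and the distance (I.1.3) of the underlying sites, `Σ_{x′∈X} e^{−δ₀|x−x′|} ≦ m·K_d(δ₀)` for every `x ∈ X`, every
`δ₀ > 0`, on EVERY torus `T^{(k)}` of the model (`K_d = B4Sect5Proof.latticeConst`; [B4] §5's torus sums via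
`B2Eq230CondShiftBound.sum_exp_neg_tdist_le`). [cite: Balaban1982Higgs2, (3.8) p.584, (3.12) p.586] -/
theorem rowSum_tdist_le_of_emb {m : ℕ} (e : X → HiggsLattice.Site P k × Fin m) (he : Function.Injective e)
    {δ₀ : ℝ} (hδ₀ : 0 < δ₀) (x : X) :
    ∑ x', Real.exp (-(δ₀ * (HiggsLattice.Site.tdist (e x).1 (e x').1 : ℝ)))
      ≤ (m : ℝ) * B4Sect5Proof.latticeConst P.d δ₀ := by
  classical
  set f : HiggsLattice.Site P k × Fin m → ℝ :=
    fun p => Real.exp (-(δ₀ * (HiggsLattice.Site.tdist (e x).1 p.1 : ℝ))) with hf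
  have hf0 : ∀ p, 0 ≤ f p := fun p => (Real.exp_pos _).le
  calc ∑ x', Real.exp (-(δ₀ * (HiggsLattice.Site.tdist (e x).1 (e x').1 : ℝ)))
      = ∑ x', f (e x') := rfl
    _ = ∑ p ∈ Finset.univ.image e, f p := (Finset.sum_image (f := f) he.injOn).symm
    _ ≤ ∑ p, f p := Finset.sum_le_univ_sum_of_nonneg fun p => hf0 p
    _ = ∑ y : HiggsLattice.Site P k, ∑ _i : Fin m, Real.exp (-(δ₀ * (HiggsLattice.Site.tdist (e x).1 y : ℝ))) :=
        Fintype.sum_prod_type _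
    _ = (m : ℝ) * ∑ y : HiggsLattice.Site P k, Real.exp (-(δ₀ * (HiggsLattice.Site.tdist (e x).1 y : ℝ))) := by
        rw [Finset.mul_sum]
        refine Finset.sum_congr rfl fun y _ => ?_
        rw [Finset.sum_const, Finset.card_univ, Fintype.card_fin, nsmul_eq_mul]
    _ ≤ (m : ℝ) * B4Sect5Proof.latticeConst P.d δ₀ :=
        mul_le_mul_of_nonneg_left (B2Eq230CondShiftBound.sum_exp_neg_tdist_le hδ₀ (e x).1) (Nat.cast_nonneg m)

variable [DecidableEq X]

/-- **(3.12), first inequality, ON THE CONCRETE LATTICE**: an operator `H` on `L²(X)`, `X ↪ T^{(k)} × Fin m`, whose kernel obeys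
(3.8) `|h(x,x′)| ≦ Ce^{−δ₁r}e^{−δ₀|x−x′|}` (distance (I.1.3) of the sites) has `‖H‖ ≦ C·m·K_d(δ₀)·e^{−δ₁r}` — the printed
`‖H′_k‖, ‖H″_k‖ ≦ O(1)exp(−δ₁r(Lᵏε))` with `O(1) = C·m·K_d(δ₀)`, independent of ε, of the torus T_ε and of k.
[cite: Balaban1982Higgs2, (3.12) p.586, (3.8) p.584] -/
theorem norm312_le {m : ℕ} (e : X → HiggsLattice.Site P k × Fin m) (he : Function.Injective e) (H : Matrix X X ℝ)
    {C δ₁ δ₀ r : ℝ} (hC : 0 ≤ C) (hδ₀ : 0 < δ₀)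
    (hk : B2StepK.KernelBound2109 (fun x x' => H x x')
      (fun x x' => (HiggsLattice.Site.tdist (e x).1 (e x').1 : ℝ)) C δ₁ δ₀ r) :
    ‖H‖ ≤ C * ((m : ℝ) * B4Sect5Proof.latticeConst P.d δ₀) * Real.exp (-(δ₁ * r)) :=
  l2_opNorm_le_of_kernelBound H hC
    (mul_nonneg (Nat.cast_nonneg m) (B4Sect5Proof.latticeConst_nonneg P.d hδ₀.le)) hk
    (fun x x' => by rw [B1Ineq234LevelZero.tdist_comm]) (rowSum_tdist_le_of_emb e he hδ₀)

end Lattice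

/-- **(3.12), second inequality, ON THE CONCRETE LATTICE** (*"≦ O(1)(Lᵏε)^κ for every κ"*): for the printed ranges
δ₁, R > 0, r > 1 of `r(ℓ) = R(1 + log ℓ⁻¹)ʳ` ((2.7)) and every κ there is `C_κ > 0` (r14's `B2StepK.rDecayBeatsPowers`) such that on
EVERY torus of the model, for every index set `X ↪ T^{(k)} × Fin m` and every operator `H` with the kernel bound (3.8) at
`r = r(ℓ)`, `0 < ℓ = Lᵏε ≦ 1`: `‖H‖ ≦ C·m·K_d(δ₀)·C_κ·ℓ^κ`.  The constant is chosen BEFORE the torus, k, X and H.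
[cite: Balaban1982Higgs2, (3.12) p.586, (2.109) p.580] -/
theorem norm312_le_pow {δ₁ R r : ℝ} (hδ : 0 < δ₁) (hR : 0 < R) (hr : 1 < r) (κ : ℝ) :
    ∃ Cκ : ℝ, 0 < Cκ ∧ ∀ {P : HiggsLattice.Params} {k : ℕ} {X : Type} [Fintype X] [DecidableEq X] {m : ℕ}
      (e : X → HiggsLattice.Site P k × Fin m), Function.Injective e → ∀ (H : Matrix X X ℝ) {C δ₀ ℓ : ℝ},
      0 ≤ C → 0 < δ₀ → 0 < ℓ → ℓ ≤ 1 →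
      B2StepK.KernelBound2109 (fun x x' => H x x')
        (fun x x' => (HiggsLattice.Site.tdist (e x).1 (e x').1 : ℝ)) C δ₁ δ₀ (B2.rFn R r ℓ) →
      ‖H‖ ≤ C * ((m : ℝ) * B4Sect5Proof.latticeConst P.d δ₀) * Cκ * ℓ ^ κ := by
  obtain ⟨Cκ, hCκ⟩ := B2StepK.rDecayBeatsPowers hδ hR hr κ
  have hCκpos : 0 < Cκ := by
    have h := hCκ 1 one_pos le_rfl
    rw [Real.one_rpow, mul_one] at h
    exact (Real.exp_pos _).trans_le h
  refine ⟨Cκ, hCκpos, ?_⟩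
  intro P k X _ _ m e he H C δ₀ ℓ hC hδ₀ hℓ hℓ1 hk
  have h1 := norm312_le e he H hC hδ₀ hk
  have hK : 0 ≤ C * ((m : ℝ) * B4Sect5Proof.latticeConst P.d δ₀) :=
    mul_nonneg hC (mul_nonneg (Nat.cast_nonneg m) (B4Sect5Proof.latticeConst_nonneg P.d hδ₀.le))
  calc ‖H‖ ≤ C * ((m : ℝ) * B4Sect5Proof.latticeConst P.d δ₀) * Real.exp (-(δ₁ * B2.rFn R r ℓ)) := h1
    _ ≤ C * ((m : ℝ) * B4Sect5Proof.latticeConst P.d δ₀) * (Cκ * ℓ ^ κ) :=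
        mul_le_mul_of_nonneg_left (hCκ ℓ hℓ hℓ1) hK
    _ = C * ((m : ℝ) * B4Sect5Proof.latticeConst P.d δ₀) * Cκ * ℓ ^ κ := by ring

/-! ## §3 The p. 586 sentence with the volume hypothesis supplied on the concrete tori -/

/-- **The p. 586 sentence ON THE CONCRETE LATTICE, threshold uniform in the volume** (p15's `B2Sect3AGaussianStep.sentence586`
with its lattice-sum hypothesis `hS` and the symmetry of the distance SUPPLIED): for the printed ranges δ₁, R > 0, r > 1 of r(ε),
constants `C ≥ 0`, `δ₀ > 0` of (3.8), `γ > 0` of (3.11) (↤ `γ₁μ₀²` resp. `γ₁m²`), a dimension `d` and a component count `m`, there is a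
threshold `ℓ₀ > 0` depending on these eight numbers only, such that for every scale `0 < ℓ = Lᵏε ≦ ℓ₀`, EVERY torus of the model of
dimension `d`, every index set `Y ↪ T^{(k)} × Fin m` (↤ `Λ₅⁽ᵏ⁾ ×` components) and all symmetric `G`, `H` on `Y` with (3.11)
`G ≧ γℓ²I` and (3.8) for the kernel of `H` at `r = r(ℓ)`: *"the operators G′_k − H′_k and G″_k − H″_k are positive and satisfy the
inequalities (3.11) with ½γ₁ instead of γ₁"* — `G − H` is positive definite and `G − H ≧ ½γℓ²I`.
[cite: Balaban1982Higgs2, p.586; (3.8) p.584; (3.11) p.585; (3.12) p.586] -/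
theorem sentence586_lattice {δ₁ R r : ℝ} (hδ : 0 < δ₁) (hR : 0 < R) (hr : 1 < r) {C δ₀ γ : ℝ} (hC : 0 ≤ C)
    (hδ₀ : 0 < δ₀) (hγ : 0 < γ) (d m : ℕ) :
    ∃ ℓ₀ : ℝ, 0 < ℓ₀ ∧ ∀ ℓ : ℝ, 0 < ℓ → ℓ ≤ ℓ₀ →
      ∀ {P : HiggsLattice.Params}, P.d = d → ∀ {k : ℕ} {Y : Type} [Fintype Y]
        (e : Y → HiggsLattice.Site P k × Fin m), Function.Injective e → ∀ (G H : Matrix Y Y ℝ),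
        G.IsSymm → H.IsSymm →
        (∀ u, γ * ℓ ^ 2 * (u ⬝ᵥ u) ≤ u ⬝ᵥ (G *ᵥ u)) →
        B2StepK.KernelBound2109 (fun x x' => H x x')
          (fun x x' => (HiggsLattice.Site.tdist (e x).1 (e x').1 : ℝ)) C δ₁ δ₀ (B2.rFn R r ℓ) →
        (G - H).PosDef ∧ ∀ u, γ / 2 * ℓ ^ 2 * (u ⬝ᵥ u) ≤ u ⬝ᵥ ((G - H) *ᵥ u) := by
  have hS : 0 ≤ (m : ℝ) * B4Sect5Proof.latticeConst d δ₀ :=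
    mul_nonneg (Nat.cast_nonneg m) (B4Sect5Proof.latticeConst_nonneg d hδ₀.le)
  obtain ⟨ℓ₀, hℓ₀, h⟩ := B2Sect3AGaussianStep.sentence586 hδ hR hr hC hS hγ
  refine ⟨ℓ₀, hℓ₀, fun ℓ hℓ hℓ0 P hPd k Y _ e he G H hGs hHs hG hk => ?_⟩
  refine h ℓ hℓ hℓ0 G H (fun x x' => (HiggsLattice.Site.tdist (e x).1 (e x').1 : ℝ)) δ₀ hGs hHs hG hk
    (fun x x' => by rw [B1Ineq234LevelZero.tdist_comm]) fun x => ?_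
  rw [← hPd]
  exact rowSum_tdist_le_of_emb e he hδ₀ x

end Literature.MathematicalPhysics.QuantumFieldTheory.Balaban1983to89.B2Ineq312OperatorNorm
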